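import Literature.Barriers.AnomalousDissipation.ObukhovCorrsinThresholdProofs
import Literature.Analysis.FunctionSpaces.BesovDifference
import HarnessLib

/-!
# The Obukhov–Corrsin threshold, Besov corner: `L¹_t B^α_{1,∞}` velocities

Barrier-audit addendum (2026-08, D-0021) to the named fact
`Literature.Barriers.AnomalousDissipation.DrivasElgindiIyerJeong2022_thm4`
(`Barriers/AnomalousDissipation/ObukhovCorrsinThreshold`, scope caveat (v)). In the
Constantin–E–Titi flux term `∫ ∇θ̄_ℓ · τ_ℓ(u,θ)` of Drivas–Elgindi–Iyer–Jeong 2022, (5.9), only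
the `L¹` translation modulus of the velocity meets sup norms of the scalar:
`‖τ_ℓ(u,θ)‖_{L¹} ≤ 2 [u]_{B^α_{1,∞}} ℓ^α [θ]_β ℓ^β`. Consequently Thm. 4 of the source holds, with
the same exponent `κ^{(α+2β-1)/(α+1)}` and the same constant, when the hypothesis
`u ∈ L¹(0,T; C^{0,α})` is weakened to `u ∈ L¹(0,T; B^α_{1,∞})` (Nikol'skii class of the `L¹`
modulus, `Literature.Analysis.FunctionSpaces.MemLpBesovSup 1 α 1`) plus boundedness of `u(t)` for
a.e. `t` (needed by the slice identity; no uniform bound). At `α = 1` this covers families of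
fields bounded in `L¹_t BV_x` (fields varying along the family, no convergence asked): scalars
bounded in `L^∞_t C^β`, `β > 0`, then dissipate at most `O(κ^β)` — closing the apparent gap
between the Hölder clause and the one-fixed-field DiPerna–Lions clause of the barrier's `blocks:`.
The inviscid (`κ = 0`) conservation statement in the full Besov scale
`θ ∈ L^{p₁}_t B^β_{p,∞}`, `u ∈ L^{q₁}_t B^α_{q,∞}`, `2/p + 1/q = 1`, `α + 2β > 1`, including the
corner `(p,q) = (∞,1)` used here, is Akramov–Wiedemann 2019, Thm. 1.

## Contents

* `BesovCorner.eLpNorm_one_commutatorRemainder_le`, `BesovCorner.integral_abs_commutator_le` —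
  the CET remainder and commutator in `L¹` against a Hölder factor;
* `BesovCorner.neg_integral_conv_mul_flux_le_of_modulus` — the slice bound
  (as `Torus.neg_integral_conv_mul_flux_le_of_holderWith`, `PassiveScalarHolderSlice`) with the
  velocity entering through its `L¹` moduli;
* `two_mul_eScalarDissipation_le_besov` — the bound (5.10) at fixed scale `ε`
  (as `DrivasElgindiIyerJeong2022_thm4.two_mul_eScalarDissipation_le`);
* `DrivasElgindiIyerJeong2022_thm4_besov` — the theorem, same shape and constant as
  `DrivasElgindiIyerJeong2022_thm4_holds` (`scale_bound`).

## Mathlib / tree search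

Tree: `TorusMollifierEstimates` (`eLpNorm_integral_smul_le_mul`,
`Torus.eLpNorm_convolution_kernel_sub_self_le`, `Torus.eLpNorm_comp_sub_sub_le_eBesovSupSeminorm`),
`TorusCommutatorEstimate` (`Torus.convolution_mul_sub_mul_convolution`,
`Torus.aestronglyMeasurable_diff_mul_diff`), `TorusMollifierHolder` (sup-norm CET (6)–(7)),
`PassiveScalarHolderSlice` (`Torus.integral_mul_inner_gradient_conv_conv_eq_sum`),
`BesovDifference` (`eBesovSupSeminorm`, `MemLpBesovSup`, `eLpBesovSupNorm`),
`ObukhovCorrsinThresholdProofs` (`setLIntegral_Ioo_le_of_ae_le`, `scale_bound`). Mathlib: no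
mixed `L¹ × C^β` commutator estimate.

## References

* T. D. Drivas, T. M. Elgindi, G. Iyer, I.-J. Jeong, Arch. Ration. Mech. Anal. 243 (2022)
  1151–1180, Thm. 4 and its proof, §5, (5.8)–(5.10) (arXiv:1911.03271). Bib key `DrivasEtAl2022`.
* I. Akramov, E. Wiedemann, *Renormalization of active scalar equations*, Nonlinear Anal. 179
  (2019) 254–269, Thm. 1 (arXiv:1805.05683). Bib key `AkramovWiedemann2019`.
* P. Constantin, W. E, E. S. Titi, Comm. Math. Phys. 165 (1994), 207–209, (6)–(11). Bib key
  `ConstantinETiti1994`.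
-/

open MeasureTheory Set Filter Topology Function
open scoped ENNReal NNReal Convolution InnerProductSpace

noncomputable section

namespace Literature.Barriers.AnomalousDissipation

open Literature.Analysis Literature.Analysis.FunctionSpaces Literature.Analysis.FluidPDE

namespace BesovCorner

variable {d : Type*} [Fintype d]

/-- **The CET remainder in `L¹` against a Hölder factor**: if the `L¹` translation modulus of
`f` at scale `ε` is at most `A_f` and `g ∈ C^b` with constant `C_g`, then
`‖r_ε(f,g)‖_{L¹} ≤ A_f · C_g ε^b`, `r_ε(f,g)(x) = ∫ k_ε(y) (f(x-y) - f(x)) (g(x-y) - g(x)) dy`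
(Minkowski–Jensen with the unit-mass kernel). [folklore] -/
theorem eLpNorm_one_commutatorRemainder_le {f g : UnitAddTorus d → ℝ}
    (hf : AEStronglyMeasurable f volume) (hgm : AEStronglyMeasurable g volume) {Cg b : ℝ≥0}
    (hg : HolderWith Cg b g) {ε : ℝ} (hε : 0 < ε) (hε' : ε ≤ 1 / 4) {Af : ℝ≥0∞}
    (hAf : ∀ y : UnitAddTorus d, ‖y‖ ≤ ε → eLpNorm (fun x => f (x - y) - f x) 1 volume ≤ Af) :
    eLpNorm (fun x => ∫ y, Torus.kernel ε y * ((f (x - y) - f x) * (g (x - y) - g x))) 1 volume ≤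
      Af * ENNReal.ofReal (Cg * ε ^ (b : ℝ)) := by
  have h := eLpNorm_integral_smul_le_mul (F := ℝ) (Torus.continuous_kernel hε hε').aestronglyMeasurable
    (Torus.aestronglyMeasurable_diff_mul_diff hf hgm) le_rfl ENNReal.one_ne_top
    (A := Af * ENNReal.ofReal (Cg * ε ^ (b : ℝ))) (Eventually.of_forall fun y hy => ?_)
  · rw [Torus.lintegral_enorm_kernel hε hε', one_mul] at h
    exact h
  · have hy' : ‖y‖ ≤ ε := (mem_ball_zero_iff.1 (Torus.support_kernel_subset hε hy)).le
    have hC0 : 0 ≤ (Cg : ℝ) * ε ^ (b : ℝ) := by positivity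
    set C : ℝ := (Cg : ℝ) * ε ^ (b : ℝ) with hCdef
    have hpt : ∀ x, ‖(f (x - y) - f x) * (g (x - y) - g x)‖ ≤ ‖(C • fun x => f (x - y) - f x) x‖ := by
      intro x
      have hgx : |g (x - y) - g x| ≤ C := Torus.abs_sub_le_of_holderWith_of_norm_le hg x hy'
      simp only [Pi.smul_apply, smul_eq_mul, Real.norm_eq_abs, abs_mul, abs_of_nonneg hC0]
      calc |f (x - y) - f x| * |g (x - y) - g x| ≤ |f (x - y) - f x| * C :=
            mul_le_mul_of_nonneg_left hgx (abs_nonneg _)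
        _ = C * |f (x - y) - f x| := mul_comm _ _
    have hsm : eLpNorm (C • fun x => f (x - y) - f x) 1 volume = ‖C‖ₑ * eLpNorm (fun x => f (x - y) - f x) 1 volume :=
      eLpNorm_const_smul C _ 1 volume
    calc eLpNorm (fun x => (f (x - y) - f x) * (g (x - y) - g x)) 1 volume
        ≤ eLpNorm (C • fun x => f (x - y) - f x) 1 volume := eLpNorm_mono hpt
      _ = ‖C‖ₑ * eLpNorm (fun x => f (x - y) - f x) 1 volume := hsm
      _ ≤ ENNReal.ofReal C * Af := by
          rw [Real.enorm_eq_ofReal hC0]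
          exact mul_le_mul_right (hAf y hy') _
      _ = Af * ENNReal.ofReal (Cg * ε ^ (b : ℝ)) := mul_comm _ _

/-- **The Constantin–E–Titi commutator in `L¹`** (mixed form: `L¹` modulus for `f`, Hölder for
`g`): for `f` bounded measurable with `L¹` translation modulus `≤ A_f` at scale `ε`, `g ∈ C^b`
continuous, `∫ |((fg) ⋆ k_ε) - (f ⋆ k_ε)(g ⋆ k_ε)| ≤ 2 A_f C_g ε^b` (the CET identity
`τ = r_ε(f,g) - (f - f ⋆ k_ε)(g - g ⋆ k_ε)`, the `L¹` remainder bound, and CET (6) in `L¹` for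
`f`, in sup norm for `g`). [folklore] -/
theorem integral_abs_commutator_le {f g : UnitAddTorus d → ℝ} (hf : AEStronglyMeasurable f volume)
    {Cf : ℝ} (hCf : ∀ x, ‖f x‖ ≤ Cf) (hgc : Continuous g) {Cg b : ℝ≥0} (hg : HolderWith Cg b g)
    {ε : ℝ} (hε : 0 < ε) (hε' : ε ≤ 1 / 4) {Af : ℝ≥0∞} (hAf' : Af ≠ ⊤)
    (hAf : ∀ y : UnitAddTorus d, ‖y‖ ≤ ε → eLpNorm (fun x => f (x - y) - f x) 1 volume ≤ Af) :
    ∫ x, |((fun y => f y * g y) ⋆ Torus.kernel ε) x - (f ⋆ Torus.kernel ε) x * (g ⋆ Torus.kernel ε) x| ≤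
      2 * (Af.toReal * (Cg * ε ^ (b : ℝ))) := by
  have hk := Torus.continuous_kernel (d := d) hε hε'
  have hfi : Integrable f volume := Integrable.mono' (integrable_const Cf) hf (Eventually.of_forall hCf)
  have hgi : Integrable g volume := hgc.integrable_unitAddTorus
  have hfg : Integrable (fun x => f x * g x) volume :=
    hgi.bdd_mul hf (Eventually.of_forall hCf)
  have hC0 : 0 ≤ (Cg : ℝ) * ε ^ (b : ℝ) := by positivity
  -- the remainder, as a real integral
  set r : UnitAddTorus d → ℝ := fun x => ∫ y, Torus.kernel ε y * ((f (x - y) - f x) * (g (x - y) - g x))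
    with hr
  have hrm : AEStronglyMeasurable r volume := by
    have hΦ : AEStronglyMeasurable (uncurry fun x y : UnitAddTorus d =>
        Torus.kernel ε y * ((f (x - y) - f x) * (g (x - y) - g x)))
        ((volume : Measure (UnitAddTorus d)).prod volume) :=
      (hk.aestronglyMeasurable.comp_snd (f := fun y : UnitAddTorus d => Torus.kernel ε y)).mul
        (Torus.aestronglyMeasurable_diff_mul_diff hf hgc.aestronglyMeasurable)
    exact hΦ.integral_prod_right'
  have hr1 : ∫ x, |r x| ≤ Af.toReal * (Cg * ε ^ (b : ℝ)) := by
    have h1 := eLpNorm_one_commutatorRemainder_le hf hgc.aestronglyMeasurable hg hε hε' hAf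
    rw [eLpNorm_one_eq_lintegral_enorm] at h1
    have h2 : ∫ x, |r x| = (∫⁻ x, ‖r x‖ₑ).toReal := by
      rw [← integral_norm_eq_lintegral_enorm hrm]
      rfl
    rw [h2, ← ENNReal.toReal_ofReal hC0, ← ENNReal.toReal_mul]
    exact ENNReal.toReal_mono (ENNReal.mul_ne_top hAf' ENNReal.ofReal_ne_top) h1
  -- the product of the two mollification errors
  set ef : UnitAddTorus d → ℝ := fun x => f x - (f ⋆ Torus.kernel ε) x with hef
  have hfk : Continuous (f ⋆ Torus.kernel ε) := Torus.continuous_convolution hfi hk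
  have hefm : AEStronglyMeasurable ef volume := hf.sub hfk.aestronglyMeasurable
  have hef1 : ∫ x, |ef x| ≤ Af.toReal := by
    have h1 := Torus.eLpNorm_convolution_kernel_sub_self_le hfi hε hε' le_rfl ENNReal.one_ne_top hAf
    rw [eLpNorm_one_eq_lintegral_enorm] at h1
    have h2 : ∫ x, |ef x| = (∫⁻ x, ‖(f ⋆ Torus.kernel ε - f) x‖ₑ).toReal := by
      rw [← integral_norm_eq_lintegral_enorm (hfk.aestronglyMeasurable.sub hf)]
      refine integral_congr_ae (Eventually.of_forall fun x => ?_)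
      simp only [hef, Pi.sub_apply, Real.norm_eq_abs, abs_sub_comm]
    rw [h2]
    exact ENNReal.toReal_mono hAf' h1
  have heg : ∀ x, |g x - (g ⋆ Torus.kernel ε) x| ≤ Cg * ε ^ (b : ℝ) := fun x => by
    rw [abs_sub_comm]
    exact Torus.abs_convolution_kernel_sub_self_le hgi hg hε hε' x
  -- assemble
  have hpt : ∀ x, |((fun y => f y * g y) ⋆ Torus.kernel ε) x - (f ⋆ Torus.kernel ε) x * (g ⋆ Torus.kernel ε) x| ≤
      |r x| + (Cg * ε ^ (b : ℝ)) * |ef x| := by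
    intro x
    rw [Torus.convolution_mul_sub_mul_convolution hfi hgi hfg hε hε' x]
    calc _ ≤ |r x| + |(f x - (f ⋆ Torus.kernel ε) x) * (g x - (g ⋆ Torus.kernel ε) x)| := abs_sub _ _
      _ ≤ |r x| + (Cg * ε ^ (b : ℝ)) * |ef x| := by
          rw [abs_mul, mul_comm (Cg * ε ^ (b : ℝ) : ℝ)]
          gcongr
          exact heg x
  have hri : Integrable (fun x => |r x|) volume := by
    -- `r` is bounded: `|r x| ≤ 2 Cf' · Cg ε^b`-type bound via the kernel average
    have hb : ∀ x, ‖r x‖ ≤ (|Cf| + |Cf|) * (Cg * ε ^ (b : ℝ)) := by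
      intro x
      rw [Real.norm_eq_abs]
      refine Torus.abs_integral_kernel_mul_le hε hε' fun y hy => ?_
      rw [abs_mul]
      refine mul_le_mul ?_ (Torus.abs_sub_le_of_holderWith_of_norm_le hg x hy.le) (abs_nonneg _) (by positivity)
      calc |f (x - y) - f x| ≤ |f (x - y)| + |f x| := abs_sub _ _
        _ ≤ |Cf| + |Cf| := add_le_add ((Real.norm_eq_abs _ ▸ hCf (x - y)).trans (le_abs_self _))
            ((Real.norm_eq_abs _ ▸ hCf x).trans (le_abs_self _))
    exact (Integrable.mono' (integrable_const _) hrm (Eventually.of_forall hb)).abs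
  have hefi : Integrable (fun x => (Cg * ε ^ (b : ℝ)) * |ef x|) volume :=
    ((hfi.sub (hfk.integrable_unitAddTorus)).abs).const_mul _
  calc ∫ x, |((fun y => f y * g y) ⋆ Torus.kernel ε) x - (f ⋆ Torus.kernel ε) x * (g ⋆ Torus.kernel ε) x|
      ≤ ∫ x, (|r x| + (Cg * ε ^ (b : ℝ)) * |ef x|) := by
        refine integral_mono_of_nonneg (Eventually.of_forall fun x => abs_nonneg _) (hri.add hefi)
          (Eventually.of_forall hpt)
    _ = (∫ x, |r x|) + (Cg * ε ^ (b : ℝ)) * ∫ x, |ef x| := by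
        rw [integral_add hri hefi, integral_const_mul]
    _ ≤ Af.toReal * (Cg * ε ^ (b : ℝ)) + (Cg * ε ^ (b : ℝ)) * Af.toReal := by
        gcongr
    _ = 2 * (Af.toReal * (Cg * ε ^ (b : ℝ))) := by ring


/-! ## The slice bound with an `L¹` translation modulus on the velocity -/

section Slice

variable [DecidableEq d] {δ : UnitAddTorus d → ℝ} {v : UnitAddTorus d → EuclideanSpace ℝ d} {ε Cv : ℝ}

/-- **The slice bound, Besov corner** (barrier audit 2026-08, scope caveat (v) of
`DrivasElgindiIyerJeong2022_thm4`): as `Torus.neg_integral_conv_mul_flux_le_of_holderWith`, but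
the Hölder hypothesis on the velocity is replaced by a bound `A_v` on the `L¹` translation moduli
of its coordinates at scale `ε` (`‖vⱼ(· - y) - vⱼ‖_{L¹} ≤ A_v` for `‖y‖ ≤ ε`):
`-∫ A G ≤ d · P · Q + κ · d · P²` with `P = (C₁/ε) C_θ ε^β` and `Q = 2 A_v C_θ ε^β`
(the flux in commutator form `∑ⱼ ∫ ∂ⱼA τⱼ`, `|∫ ∂ⱼA τⱼ| ≤ sup|∂ⱼA| · ‖τⱼ‖_{L¹}`, and the `L¹`
commutator estimate `integral_abs_commutator_le`). [folklore] -/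
theorem neg_integral_conv_mul_flux_le_of_modulus (hδ : Continuous δ) {Cθ β : ℝ≥0}
    (hδH : HolderWith Cθ β δ) (hv : AEStronglyMeasurable v volume) (hCv : ∀ y, ‖v y‖ ≤ Cv)
    (hdiv : FunctionSpaces.Torus.IsWeaklyDivFree v) (hε : 0 < ε) (hε' : ε ≤ 1 / 4)
    {Av : ℝ≥0∞} (hAv' : Av ≠ ⊤)
    (hAv : ∀ j, ∀ y : UnitAddTorus d, ‖y‖ ≤ ε → eLpNorm (fun x => v (x - y) j - v x j) 1 volume ≤ Av)
    {κ : ℝ} (hκ : 0 ≤ κ) :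
    -(∫ x, (δ ⋆ FunctionSpaces.Torus.kernel ε) x * ∫ y, δ y *
        (-⟪v y, FunctionSpaces.Torus.gradient (FunctionSpaces.Torus.kernel ε) (x - y)⟫_ℝ +
          κ * FunctionSpaces.Torus.laplacian (FunctionSpaces.Torus.kernel ε) (x - y))) ≤
      Fintype.card d * (ε⁻¹ * FunctionSpaces.Torus.gradProfileMass d * (Cθ * ε ^ (β : ℝ))) *
          (2 * (Av.toReal * (Cθ * ε ^ (β : ℝ)))) +
        κ * (Fintype.card d * (ε⁻¹ * FunctionSpaces.Torus.gradProfileMass d * (Cθ * ε ^ (β : ℝ))) ^ 2) := by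
  set k : UnitAddTorus d → ℝ := FunctionSpaces.Torus.kernel ε with hk_def
  have hk : FunctionSpaces.Torus.IsSmooth k := FunctionSpaces.Torus.isSmooth_kernel hε hε'
  have hkc : Continuous k := hk.continuous
  have hδi : Integrable δ volume := hδ.integrable_unitAddTorus
  have hA : FunctionSpaces.Torus.IsSmooth (δ ⋆ k) := FunctionSpaces.Torus.isSmooth_convolution hδi hk
  have hA1 : FunctionSpaces.Torus.IsContDiff 1 (δ ⋆ k) := hA.isContDiff (by simp)
  have hvI := fun j => Torus.integrable_apply_mul_of_norm_le hδ hv hCv j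
  rw [Torus.integral_conv_mul_flux_eq hδi hv (Eventually.of_forall hCv) hε hε' κ, neg_sub]
  set P : ℝ := ε⁻¹ * FunctionSpaces.Torus.gradProfileMass d * (Cθ * ε ^ (β : ℝ)) with hP
  set Q : ℝ := 2 * (Av.toReal * (Cθ * ε ^ (β : ℝ))) with hQ
  have hP0 : 0 ≤ P :=
    mul_nonneg (mul_nonneg (inv_nonneg.2 hε.le) FunctionSpaces.Torus.gradProfileMass_nonneg) (by positivity)
  have hPj : ∀ j x, |FunctionSpaces.Torus.partialDeriv j (δ ⋆ k) x| ≤ P := fun j x =>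
    FunctionSpaces.Torus.abs_partialDeriv_convolution_kernel_le hδi hδH hε hε' j x
  -- the `L¹` commutator bound, coordinatewise
  have hτ : ∀ j, ∫ x, |((fun y => v y j * δ y) ⋆ k) x - ((fun y => v y j) ⋆ k) x * (δ ⋆ k) x| ≤ Q := by
    intro j
    have hvjm : AEStronglyMeasurable (fun y => v y j) volume := (hvI j).2.1.aestronglyMeasurable
    have hvjb : ∀ x, ‖v x j‖ ≤ Cv := fun x => (PiLp.norm_apply_le (v x) j).trans (hCv x)
    exact integral_abs_commutator_le hvjm hvjb hδ hδH hε hε' hAv' (hAv j)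
  -- (a) the transport pairing
  have ha : |∫ y, δ y * ⟪v y, FunctionSpaces.Torus.gradient ((δ ⋆ k) ⋆ k) y⟫_ℝ| ≤ Fintype.card d * P * Q := by
    rw [Torus.integral_mul_inner_gradient_conv_conv_eq_sum hδ hv hCv hdiv hε hε']
    refine (Finset.abs_sum_le_sum_abs _ _).trans ?_
    have hj : ∀ j, |∫ x, FunctionSpaces.Torus.partialDeriv j (δ ⋆ k) x *
        (((fun y => v y j * δ y) ⋆ k) x - ((fun y => v y j) ⋆ k) x * (δ ⋆ k) x)| ≤ P * Q := by
      intro j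
      set τ : UnitAddTorus d → ℝ := fun x =>
        ((fun y => v y j * δ y) ⋆ k) x - ((fun y => v y j) ⋆ k) x * (δ ⋆ k) x with hτdef
      have hτc : Continuous τ :=
        (FunctionSpaces.Torus.continuous_convolution (hvI j).2.2 hkc).sub
          ((FunctionSpaces.Torus.continuous_convolution (hvI j).2.1 hkc).mul hA.continuous)
      have hτi : Integrable (fun x => |τ x|) volume := hτc.integrable_unitAddTorus.abs
      calc |∫ x, FunctionSpaces.Torus.partialDeriv j (δ ⋆ k) x * τ x|
          ≤ ∫ x, |FunctionSpaces.Torus.partialDeriv j (δ ⋆ k) x * τ x| := by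
            simpa only [Real.norm_eq_abs] using
              norm_integral_le_integral_norm (fun x => FunctionSpaces.Torus.partialDeriv j (δ ⋆ k) x * τ x)
        _ ≤ ∫ x, P * |τ x| := by
            refine integral_mono_of_nonneg (Eventually.of_forall fun x => abs_nonneg _) (hτi.const_mul P)
              (Eventually.of_forall fun x => ?_)
            show |FunctionSpaces.Torus.partialDeriv j (δ ⋆ k) x * τ x| ≤ P * |τ x|
            rw [abs_mul]
            exact mul_le_mul_of_nonneg_right (hPj j x) (abs_nonneg _)
        _ = P * ∫ x, |τ x| := integral_const_mul _ _
        _ ≤ P * Q := mul_le_mul_of_nonneg_left (hτ j) hP0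
    calc ∑ j, |∫ x, FunctionSpaces.Torus.partialDeriv j (δ ⋆ k) x *
          (((fun y => v y j * δ y) ⋆ k) x - ((fun y => v y j) ⋆ k) x * (δ ⋆ k) x)|
        ≤ ∑ _j : d, P * Q := Finset.sum_le_sum fun j _ => hj j
      _ = Fintype.card d * P * Q := by
          rw [Finset.sum_const, Finset.card_univ, nsmul_eq_mul]
          ring
  -- (b) the resolved dissipation
  have hb : ∫ x, ‖FunctionSpaces.Torus.gradient (δ ⋆ k) x‖ ^ 2 ≤ Fintype.card d * P ^ 2 := by
    have hpt : ∀ x, ‖FunctionSpaces.Torus.gradient (δ ⋆ k) x‖ ^ 2 ≤ Fintype.card d * P ^ 2 := by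
      intro x
      rw [EuclideanSpace.norm_sq_eq]
      calc ∑ j, ‖FunctionSpaces.Torus.gradient (δ ⋆ k) x j‖ ^ 2 ≤ ∑ _j : d, P ^ 2 := by
            refine Finset.sum_le_sum fun j _ => ?_
            rw [FunctionSpaces.Torus.gradient_apply hA1, Real.norm_eq_abs]
            exact pow_le_pow_left₀ (abs_nonneg _) (hPj j x) 2
        _ = Fintype.card d * P ^ 2 := by
            rw [Finset.sum_const, Finset.card_univ, nsmul_eq_mul]
    calc ∫ x, ‖FunctionSpaces.Torus.gradient (δ ⋆ k) x‖ ^ 2 ≤ ∫ _x : UnitAddTorus d, (Fintype.card d * P ^ 2 : ℝ) :=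
          integral_mono ((hA.gradient.continuous.norm.pow 2 :
            Continuous fun x => ‖FunctionSpaces.Torus.gradient (δ ⋆ k) x‖ ^ 2).integrable_unitAddTorus)
            (integrable_const _) hpt
      _ = Fintype.card d * P ^ 2 := by simp
  have ha' := (neg_le_abs _).trans ha
  have hb' := mul_le_mul_of_nonneg_left hb hκ
  linarith

end Slice

end BesovCorner

/-! ## The dissipation bound at a fixed scale, Besov corner -/

/-- **The bound (5.10) at `t = 0`, Besov corner** (barrier audit 2026-08, scope caveat (v) of
`DrivasElgindiIyerJeong2022_thm4`): as
`DrivasElgindiIyerJeong2022_thm4.two_mul_eScalarDissipation_le`, with the velocity hypothesis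
`u ∈ L¹_t C^{0,α}_x`, `‖u‖ ≤ K` replaced by slicewise boundedness (no uniformity) and
`u ∈ L¹_t B^α_{1,∞}`, `‖u‖_{L¹_t B^α_{1,∞}} ≤ K` (`MemLpBesovSup 1 α 1`, `eLpBesovSupNorm 1 α 1`);
same right-hand side. Original docstring of the Hölder version: the printed bound (DEIJ 2022, proof of
Thm. 4): under the hypotheses of the named fact for one solution (`u ∈ L¹C^α` with
`‖u‖_{L¹C^α} ≤ K`, `‖θ₀‖_{C^β} ≤ M`, energy balance, `ess sup ‖θ(t)‖_{C^β} ≤ M`) and a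
mollification scale `0 < ε ≤ 1/4`,
`2κ ∫₀ᵀ ‖∇θ‖²_{L²} ≤ M² ε^{2β} + 2 (2 d C₁ M² ε^{α+2β-1} K + T κ d C₁² M² ε^{2β-2})`,
`C₁ = Torus.gradProfileMass d`, `d = card d`. [cite: DrivasEtAl2022, proof of Thm. 4, (5.9)–(5.10)] -/
theorem two_mul_eScalarDissipation_le_besov {d : Type*} [Fintype d]
    [DecidableEq d] {T : ℝ} (hT : 0 < T) {α β : ℝ≥0} (hα : 0 < α) (hβ : 0 < β) {K M : ℝ≥0}
    {u : ℝ → UnitAddTorus d → EuclideanSpace ℝ d}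
    (hub : ∀ᵐ t ∂((volume : Measure ℝ).restrict (Ioo 0 T)), eSupNorm (u t) < ⊤)
    (hu : MemLpBesovSup 1 (α : ℝ) 1 u volume (Ioo 0 T))
    (huK : eLpBesovSupNorm 1 (α : ℝ) 1 u volume (Ioo 0 T) ≤ K) {θ₀ : UnitAddTorus d → ℝ}
    (hθ₀ : eBoundedHolderNorm β θ₀ ≤ M) {κ : ℝ} (hκ : 0 < κ) {θ : ℝ → UnitAddTorus d → ℝ}
    (hθ : Torus.IsWeakScalarTransportOn T κ u θ₀ θ)
    (henergy : ∀ᵐ t ∂((volume : Measure ℝ).restrict (Ioo 0 T)),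
      (∫⁻ x, ‖θ t x‖ₑ ^ 2) + 2 * Torus.eScalarDissipation κ θ 0 t ≤ ∫⁻ x, ‖θ₀ x‖ₑ ^ 2)
    (hbound : ∀ᵐ t ∂((volume : Measure ℝ).restrict (Ioo 0 T)), eBoundedHolderNorm β (θ t) ≤ M)
    {ε : ℝ} (hε : 0 < ε) (hε' : ε ≤ 1 / 4) :
    2 * Torus.eScalarDissipation κ θ 0 T ≤ ENNReal.ofReal
      ((M : ℝ) ^ 2 * ε ^ (2 * (β : ℝ)) +
        2 * ((2 * Fintype.card d * Torus.gradProfileMass d * (M : ℝ) ^ 2 * ε ^ ((α : ℝ) + 2 * β - 1)) * K +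
          T * (κ * (Fintype.card d * (Torus.gradProfileMass d ^ 2 * (M : ℝ) ^ 2 * ε ^ (2 * (β : ℝ) - 2)))))) := by
  -- the datum
  have hMtop : ((M : ℝ≥0∞)) < ⊤ := ENNReal.coe_lt_top
  have nn_le : ∀ {f : UnitAddTorus d → ℝ}, eBoundedHolderNorm β f ≤ M → HolderWith M β f ∧ Continuous f := by
    intro f hf
    have hB : MemBoundedHolder β f := lt_of_le_of_lt hf hMtop
    refine ⟨Torus.holderWith_of_nnHolderNorm_le hB.memHolder (ENNReal.coe_le_coe.1 ?_), hB.continuous hβ⟩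
    rw [hB.memHolder.coe_nnHolderNorm_eq_eHolderNorm]
    exact (eHolderNorm_le_eBoundedHolderNorm β f).trans hf
  have hθ₀H : HolderWith M β θ₀ := (nn_le hθ₀).1
  have hθ₀c : Continuous θ₀ := (nn_le hθ₀).2
  have hθ₀i : Integrable θ₀ volume := hθ₀c.integrable_unitAddTorus
  set k : UnitAddTorus d → ℝ := Torus.kernel ε with hk_def
  have hk : Torus.IsSmooth k := Torus.isSmooth_kernel hε hε'
  -- constants and exponent bookkeeping
  set C₁ : ℝ := Torus.gradProfileMass d with hC₁
  have hC₁0 : 0 ≤ C₁ := Torus.gradProfileMass_nonneg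
  set c₁ : ℝ := 2 * Fintype.card d * C₁ * (M : ℝ) ^ 2 * ε ^ ((α : ℝ) + 2 * β - 1) with hc₁
  set c₂ : ℝ := κ * (Fintype.card d * (C₁ ^ 2 * (M : ℝ) ^ 2 * ε ^ (2 * (β : ℝ) - 2))) with hc₂
  have hc₁0 : 0 ≤ c₁ := by positivity
  have hc₂0 : 0 ≤ c₂ := by positivity
  have i1 : ((M : ℝ) * ε ^ (β : ℝ)) ^ 2 = (M : ℝ) ^ 2 * ε ^ (2 * (β : ℝ)) := by
    rw [mul_pow, ← Real.rpow_natCast (ε ^ (β : ℝ)) 2, ← Real.rpow_mul hε.le]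
    congr 2
    push_cast
    ring
  have i2 : ε⁻¹ * ε ^ (β : ℝ) * ε ^ (α : ℝ) * ε ^ (β : ℝ) = ε ^ ((α : ℝ) + 2 * β - 1) := by
    rw [← Real.rpow_neg_one ε, ← Real.rpow_add hε, ← Real.rpow_add hε, ← Real.rpow_add hε]
    congr 1
    ring
  have i3 : (ε⁻¹ * ε ^ (β : ℝ)) ^ 2 = ε ^ (2 * (β : ℝ) - 2) := by
    rw [← Real.rpow_neg_one ε, ← Real.rpow_add hε, ← Real.rpow_natCast _ 2, ← Real.rpow_mul hε.le]
    congr 1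
    push_cast
    ring
  -- Step 1: the slice bound, for a.e. `s`
  have hslice : ∀ᵐ s ∂((volume : Measure ℝ).restrict (Ioo 0 T)),
      -(∫ x, ((θ s) ⋆ k) x * ∫ y, θ s y *
        (-⟪u s y, Torus.gradient k (x - y)⟫_ℝ + κ * Torus.laplacian k (x - y))) ≤
        c₁ * (eBesovSupNorm (α : ℝ) 1 (u s) volume).toReal + c₂ := by
    filter_upwards [hbound, hu.1, hub, hθ.ae_isWeaklyDivFree, hθ.ae_aestronglyMeasurable_velocity_slice]
      with s hsM hsu hsb hdiv hum
    have hθsH : HolderWith M β (θ s) := (nn_le hsM).1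
    have hθsc : Continuous (θ s) := (nn_le hsM).2
    have hCv : ∀ y, ‖u s y‖ ≤ (eSupNorm (u s)).toReal := fun y => by
      rw [← toReal_enorm]
      exact ENNReal.toReal_mono hsb.ne (enorm_le_eSupNorm (u s) y)
    -- the `L¹` translation modulus of `u s` at scale `ε`
    set S : ℝ≥0∞ := eBesovSupSeminorm (α : ℝ) 1 (u s) volume with hS
    have hStop : S ≠ ⊤ := hsu.2.ne
    have hNtop : eBesovSupNorm (α : ℝ) 1 (u s) volume ≠ ⊤ :=
      ENNReal.add_ne_top.2 ⟨hsu.1.eLpNorm_ne_top, hStop⟩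
    have hSN : S ≤ eBesovSupNorm (α : ℝ) 1 (u s) volume := le_add_self
    set Av : ℝ≥0∞ := S * ENNReal.ofReal (ε ^ (α : ℝ)) with hAv
    have hAvtop : Av ≠ ⊤ := ENNReal.mul_ne_top hStop ENNReal.ofReal_ne_top
    have hAvj : ∀ j, ∀ y : UnitAddTorus d, ‖y‖ ≤ ε →
        eLpNorm (fun x => u s (x - y) j - u s x j) 1 volume ≤ Av := by
      intro j y hy
      have hcomp : eLpNorm (fun x => u s (x - y) j - u s x j) 1 volume ≤
          eLpNorm (fun x => u s (x - y) - u s x) 1 volume := by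
        refine eLpNorm_mono fun x => ?_
        rw [← PiLp.sub_apply]
        exact PiLp.norm_apply_le (u s (x - y) - u s x) j
      exact hcomp.trans (Torus.eLpNorm_comp_sub_sub_le_eBesovSupSeminorm (by exact_mod_cast hα) hy)
    have h := BesovCorner.neg_integral_conv_mul_flux_le_of_modulus hθsc hθsH hum hCv hdiv hε hε'
      hAvtop hAvj hκ.le
    have hAvR : Av.toReal = S.toReal * ε ^ (α : ℝ) := by
      rw [hAv, ENNReal.toReal_mul, ENNReal.toReal_ofReal (Real.rpow_nonneg hε.le _)]
    have hSle : S.toReal ≤ (eBesovSupNorm (α : ℝ) 1 (u s) volume).toReal :=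
      ENNReal.toReal_mono hNtop hSN
    have hS0 : 0 ≤ S.toReal := ENNReal.toReal_nonneg
    calc _ ≤ _ := h
      _ = c₁ * S.toReal + c₂ := by
          rw [hAvR, hc₁, hc₂, ← i2, ← i3]
          ring
      _ ≤ c₁ * (eBesovSupNorm (α : ℝ) 1 (u s) volume).toReal + c₂ := by gcongr
  -- Step 2: the time integral of the slice bound, in `ℝ≥0∞`
  have hKint : ∫⁻ s in Ioo 0 T, ENNReal.ofReal ((eBesovSupNorm (α : ℝ) 1 (u s) volume).toReal) ≤ K := by
    have e : ∫⁻ s in Ioo 0 T, ENNReal.ofReal ((eBesovSupNorm (α : ℝ) 1 (u s) volume).toReal) = eLpBesovSupNorm 1 (α : ℝ) 1 u volume (Ioo 0 T) := by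
      rw [eLpBesovSupNorm, eLpNorm_one_eq_lintegral_enorm]
      refine lintegral_congr fun s => ?_
      exact (Real.enorm_eq_ofReal ENNReal.toReal_nonneg).symm
    rw [e]
    exact huK
  have htime : ∀ t ∈ Ioo 0 T,
      ENNReal.ofReal (∫ s in Ioc 0 t, -(∫ x, ((θ s) ⋆ k) x * ∫ y, θ s y *
        (-⟪u s y, Torus.gradient k (x - y)⟫_ℝ + κ * Torus.laplacian k (x - y)))) ≤
        ENNReal.ofReal c₁ * K + ENNReal.ofReal c₂ * ENNReal.ofReal T := by
    intro t ht
    refine (ofReal_integral_le_lintegral_ofReal _).trans ?_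
    refine (lintegral_mono_set (Ioc_subset_Ioo_right ht.2)).trans ?_
    have hmono : ∫⁻ s in Ioo 0 T, ENNReal.ofReal (-(∫ x, ((θ s) ⋆ k) x * ∫ y, θ s y *
        (-⟪u s y, Torus.gradient k (x - y)⟫_ℝ + κ * Torus.laplacian k (x - y)))) ≤
        ∫⁻ s in Ioo 0 T, (ENNReal.ofReal c₁ * ENNReal.ofReal ((eBesovSupNorm (α : ℝ) 1 (u s) volume).toReal) + ENNReal.ofReal c₂) := by
      refine lintegral_mono_ae (hslice.mono fun s hs => ?_)
      have hb0 : 0 ≤ (eBesovSupNorm (α : ℝ) 1 (u s) volume).toReal := ENNReal.toReal_nonneg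
      rw [← ENNReal.ofReal_mul hc₁0, ← ENNReal.ofReal_add (mul_nonneg hc₁0 hb0) hc₂0]
      exact ENNReal.ofReal_le_ofReal hs
    refine hmono.trans ?_
    rw [lintegral_add_right _ measurable_const, lintegral_const_mul' _ _ ENNReal.ofReal_ne_top,
      lintegral_const, Measure.restrict_apply_univ, Real.volume_Ioo, sub_zero]
    gcongr
  -- Step 3: the bound for a.e. `t`
  have hmain : ∀ᵐ t ∂((volume : Measure ℝ).restrict (Ioo 0 T)), 2 * Torus.eScalarDissipation κ θ 0 t ≤
      ENNReal.ofReal ((M : ℝ) ^ 2 * ε ^ (2 * (β : ℝ))) + 2 * (ENNReal.ofReal c₁ * K + ENNReal.ofReal c₂ * ENNReal.ofReal T) := by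
    filter_upwards [henergy, hθ.ae_integral_sq_molInt_eq hθ₀i hk, ae_restrict_mem measurableSet_Ioo,
      hθ.ae_slice_integrable₁] with t hen hid htT hint
    have hθti : Integrable (θ t) volume := hint.1
    have hAc : Continuous ((θ t) ⋆ k) := Torus.continuous_convolution hθti hk.continuous
    -- Young: `‖θ(t) ⋆ k‖₂ ≤ ‖θ(t)‖₂`
    have hY : ∫⁻ x, ‖((θ t) ⋆ k) x‖ₑ ^ 2 ≤ ∫⁻ x, ‖θ t x‖ₑ ^ 2 := by
      rw [← PassiveScalarProofs.eLpNorm_two_pow_two, ← PassiveScalarProofs.eLpNorm_two_pow_two]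
      gcongr
      calc eLpNorm ((θ t) ⋆ k) 2 volume ≤ (∫⁻ y, ‖k y‖ₑ) * eLpNorm (θ t) 2 volume :=
            Torus.eLpNorm_convolution_le hθti.aestronglyMeasurable hk.continuous.aestronglyMeasurable one_le_two
        _ = eLpNorm (θ t) 2 volume := by rw [hk_def, Torus.lintegral_enorm_kernel hε hε', one_mul]
    have e0 : ∫⁻ x, ‖θ₀ x‖ₑ ^ 2 = ENNReal.ofReal (∫ x, θ₀ x ^ 2) :=
      Torus.lintegral_enorm_sq_eq_ofReal_integral_sq hθ₀c
    have eA : ∫⁻ x, ‖((θ t) ⋆ k) x‖ₑ ^ 2 = ENNReal.ofReal (∫ x, ((θ t) ⋆ k) x ^ 2) :=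
      Torus.lintegral_enorm_sq_eq_ofReal_integral_sq hAc
    have h1 : ENNReal.ofReal (∫ x, ((θ t) ⋆ k) x ^ 2) + 2 * Torus.eScalarDissipation κ θ 0 t ≤
        ENNReal.ofReal (∫ x, θ₀ x ^ 2) := by
      rw [← eA, ← e0]
      exact (add_le_add hY le_rfl).trans hen
    have h2 : 2 * Torus.eScalarDissipation κ θ 0 t ≤
        ENNReal.ofReal ((∫ x, θ₀ x ^ 2) - ∫ x, ((θ t) ⋆ k) x ^ 2) := by
      rw [ENNReal.ofReal_sub _ (integral_nonneg fun x => sq_nonneg _)]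
      exact ENNReal.le_sub_of_add_le_left ENNReal.ofReal_ne_top h1
    have h3 : (∫ x, θ₀ x ^ 2) - ∫ x, ((θ t) ⋆ k) x ^ 2 ≤ (M : ℝ) ^ 2 * ε ^ (2 * (β : ℝ)) +
        2 * ∫ s in Ioc 0 t, -(∫ x, ((θ s) ⋆ k) x * ∫ y, θ s y *
          (-⟪u s y, Torus.gradient k (x - y)⟫_ℝ + κ * Torus.laplacian k (x - y))) := by
      rw [hid, integral_neg, ← i1]
      have := Torus.integral_sq_sub_integral_convolution_sq_le hθ₀c hθ₀H hε hε'
      linarith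
    calc 2 * Torus.eScalarDissipation κ θ 0 t
        ≤ ENNReal.ofReal ((∫ x, θ₀ x ^ 2) - ∫ x, ((θ t) ⋆ k) x ^ 2) := h2
      _ ≤ ENNReal.ofReal ((M : ℝ) ^ 2 * ε ^ (2 * (β : ℝ)) +
          2 * ∫ s in Ioc 0 t, -(∫ x, ((θ s) ⋆ k) x * ∫ y, θ s y *
            (-⟪u s y, Torus.gradient k (x - y)⟫_ℝ + κ * Torus.laplacian k (x - y)))) :=
          ENNReal.ofReal_le_ofReal h3
      _ ≤ ENNReal.ofReal ((M : ℝ) ^ 2 * ε ^ (2 * (β : ℝ))) +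
          ENNReal.ofReal (2 * ∫ s in Ioc 0 t, -(∫ x, ((θ s) ⋆ k) x * ∫ y, θ s y *
            (-⟪u s y, Torus.gradient k (x - y)⟫_ℝ + κ * Torus.laplacian k (x - y)))) :=
          ENNReal.ofReal_add_le
      _ ≤ _ := by
          rw [ENNReal.ofReal_mul zero_le_two, ENNReal.ofReal_ofNat]
          gcongr
          exact htime t htT
  -- Step 4: from a.e. `t` to `T`
  have h2D : ∀ t, 2 * Torus.eScalarDissipation κ θ 0 t =
      ∫⁻ s in Ioo 0 t, 2 * (ENNReal.ofReal κ * Torus.eScalarGradNormSq (θ s)) := fun t => by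
    rw [Torus.eScalarDissipation, ← lintegral_const_mul' _ _ ENNReal.ofReal_ne_top,
      ← lintegral_const_mul' _ _ ENNReal.ofNat_ne_top]
  have hfin : 2 * Torus.eScalarDissipation κ θ 0 T ≤
      ENNReal.ofReal ((M : ℝ) ^ 2 * ε ^ (2 * (β : ℝ))) + 2 * (ENNReal.ofReal c₁ * K + ENNReal.ofReal c₂ * ENNReal.ofReal T) := by
    rw [h2D]
    refine setLIntegral_Ioo_le_of_ae_le hT ?_
    filter_upwards [hmain] with t ht
    rwa [h2D] at ht
  refine hfin.trans (le_of_eq ?_)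
  rw [ENNReal.ofReal_add (by positivity) (by positivity), ENNReal.ofReal_mul zero_le_two, ENNReal.ofReal_ofNat,
    ENNReal.ofReal_add (by positivity) (by positivity), ENNReal.ofReal_mul hc₁0, ENNReal.ofReal_coe_nnreal,
    ENNReal.ofReal_mul (le_of_lt hT), mul_comm (ENNReal.ofReal T) (ENNReal.ofReal c₂)]


/-! ## The theorem, Besov corner -/

/-- **The Obukhov–Corrsin threshold with an `L¹`-Besov velocity** (barrier audit 2026-08: scope
caveat (v) of `DrivasElgindiIyerJeong2022_thm4` made a theorem). Same statement as the named
fact `DrivasElgindiIyerJeong2022_thm4`, except that the velocity hypothesis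
`u ∈ L¹(0,T; C^{0,α})`, `‖u‖_{L¹C^{0,α}} ≤ K` is replaced by: `u(t)` bounded for a.e. `t` (no
uniformity) and `u ∈ L¹(0,T; B^α_{1,∞})` with `‖u‖_{L¹_t B^α_{1,∞}} ≤ K`, where
`B^α_{1,∞}` is the Nikol'skii space of the `L¹` translation modulus (`MemLpBesovSup 1 α 1`,
`eLpBesovSupNorm 1 α 1`, `BesovDifference`): for `0 < κ ≤ κ₀` the scalar dissipation is
`≤ C κ^{(α+2β-1)/(α+1)}` with `C = C(d, T, α, β, K, M, κ₀)` (the same constant as in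
`DrivasElgindiIyerJeong2022_thm4_holds`). In particular, along any family of fields bounded in
`L¹_t BV_x ⊂ L¹_t B¹_{1,∞}` (fields may vary along the family), scalars bounded in
`L^∞_t C^β`, `β > 0`, dissipate at most `O(κ^β)`. The velocity enters the flux only through
`‖τ_ℓ(u,θ)‖_{L¹} ≤ 2 [u]_{B^α_{1,∞}} ℓ^α [θ]_β ℓ^β` (`BesovCorner.integral_abs_commutator_le`);
cf. the Besov renormalisation theorem for inviscid transport, corner `(p,q) = (∞,1)`.
[cite: AkramovWiedemann2019, Thm. 1] [cite: DrivasEtAl2022, Thm. 4 and its proof] -/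
theorem DrivasElgindiIyerJeong2022_thm4_besov (d : Type) [Fintype d] [DecidableEq d] (T : ℝ)
    (hT : 0 < T) (α β : ℝ≥0) (hα : 0 < α ∧ α ≤ 1) (hβ : 0 < β ∧ β ≤ 1) (K M κ₀ : ℝ≥0) :
    ∃ C : ℝ≥0,
      ∀ (u : ℝ → UnitAddTorus d → EuclideanSpace ℝ d)
        (_hub : ∀ᵐ t ∂(volume.restrict (Ioo 0 T)), eSupNorm (u t) < ⊤)
        (_hu : MemLpBesovSup 1 (α : ℝ) 1 u volume (Ioo 0 T))
        (_huK : eLpBesovSupNorm 1 (α : ℝ) 1 u volume (Ioo 0 T) ≤ K)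
        (θ₀ : UnitAddTorus d → ℝ) (_hθ₀ : eBoundedHolderNorm β θ₀ ≤ M)
        (κ : ℝ) (_hκ : 0 < κ) (_hκ₀ : κ ≤ κ₀)
        (θ : ℝ → UnitAddTorus d → ℝ) (_hθ : Torus.IsWeakScalarTransportOn T κ u θ₀ θ)
        (_henergy : ∀ᵐ t ∂(volume.restrict (Ioo 0 T)),
          (∫⁻ x, ‖θ t x‖ₑ ^ 2) + 2 * Torus.eScalarDissipation κ θ 0 t ≤ ∫⁻ x, ‖θ₀ x‖ₑ ^ 2)
        (_hbound : ∀ᵐ t ∂(volume.restrict (Ioo 0 T)), eBoundedHolderNorm β (θ t) ≤ M),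
        Torus.eScalarDissipation κ θ 0 T ≤
          ENNReal.ofReal (C * κ ^ (((α : ℝ) + 2 * β - 1) / (α + 1))) := by
  rcases eq_zero_or_pos κ₀ with hκ₀ | hκ₀
  · refine ⟨0, ?_⟩
    intro u _ _ _ θ₀ _ κ hκ hκκ₀
    exact absurd (hκ.trans_le hκκ₀) (by simp [hκ₀])
  -- the scale `ε = c κ^γ`
  set γ : ℝ := ((α : ℝ) + 1)⁻¹ with hγ
  have hα1pos : (0 : ℝ) < α + 1 := by positivity
  have hγ0 : 0 ≤ γ := by positivity
  have hκ₀' : (0 : ℝ) < κ₀ := hκ₀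
  set c : ℝ := 4⁻¹ * (κ₀ : ℝ) ^ (-γ) with hc
  have hc0 : 0 < c := by positivity
  set C₁ : ℝ := Torus.gradProfileMass d with hC₁
  have hC₁0 : 0 ≤ C₁ := Torus.gradProfileMass_nonneg
  set Cr : ℝ := 2⁻¹ * ((M : ℝ) ^ 2 * (c ^ (2 * (β : ℝ)) * (κ₀ : ℝ) ^ ((1 - (α : ℝ)) * γ)) +
      (2 * (2 * Fintype.card d * C₁ * (M : ℝ) ^ 2) * K) * c ^ ((α : ℝ) + 2 * β - 1) +
      (2 * (T * (Fintype.card d * (C₁ ^ 2 * (M : ℝ) ^ 2)))) * c ^ (2 * (β : ℝ) - 2)) with hCr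
  have hCr0 : 0 ≤ Cr := by positivity
  refine ⟨Cr.toNNReal, ?_⟩
  intro u hub hu huK θ₀ hθ₀ κ hκ hκκ₀ θ hθ henergy hbound
  set ε : ℝ := c * κ ^ γ with hε_def
  have hε : 0 < ε := by positivity
  have hε' : ε ≤ 1 / 4 := by
    have h1 : κ ^ γ ≤ (κ₀ : ℝ) ^ γ := Real.rpow_le_rpow hκ.le (by exact_mod_cast hκκ₀) hγ0
    have h2 : (κ₀ : ℝ) ^ (-γ) * (κ₀ : ℝ) ^ γ = 1 := by
      rw [Real.rpow_neg hκ₀'.le, inv_mul_cancel₀ (Real.rpow_pos_of_pos hκ₀' γ).ne']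
    calc ε = 4⁻¹ * ((κ₀ : ℝ) ^ (-γ) * κ ^ γ) := by rw [hε_def, hc, mul_assoc]
      _ ≤ 4⁻¹ * ((κ₀ : ℝ) ^ (-γ) * (κ₀ : ℝ) ^ γ) := by gcongr
      _ = 1 / 4 := by rw [h2]; norm_num
  have hraw := two_mul_eScalarDissipation_le_besov hT hα.1 hβ.1 hub hu huK hθ₀ hκ hθ
    henergy hbound hε hε'
  -- optimisation in `ℓ`
  have hscale := scale_bound (β := (β : ℝ)) (2 * (2 * Fintype.card d * C₁ * (M : ℝ) ^ 2) * K)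
    (2 * (T * (Fintype.card d * (C₁ ^ 2 * (M : ℝ) ^ 2)))) (by exact_mod_cast hα.2) hα1pos hκ
    (by exact_mod_cast hκκ₀) hc0 hγ (sq_nonneg (M : ℝ))
  have hreal : (M : ℝ) ^ 2 * ε ^ (2 * (β : ℝ)) +
      2 * ((2 * Fintype.card d * C₁ * (M : ℝ) ^ 2 * ε ^ ((α : ℝ) + 2 * β - 1)) * K +
        T * (κ * (Fintype.card d * (C₁ ^ 2 * (M : ℝ) ^ 2 * ε ^ (2 * (β : ℝ) - 2))))) ≤
      2 * ((Cr.toNNReal : ℝ≥0) * κ ^ (((α : ℝ) + 2 * β - 1) / (α + 1))) := by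
    rw [Real.coe_toNNReal _ hCr0, hCr]
    calc _ = (M : ℝ) ^ 2 * (c * κ ^ γ) ^ (2 * (β : ℝ)) +
          2 * (2 * Fintype.card d * C₁ * (M : ℝ) ^ 2) * K * (c * κ ^ γ) ^ ((α : ℝ) + 2 * β - 1) +
          2 * (T * (Fintype.card d * (C₁ ^ 2 * (M : ℝ) ^ 2))) * (κ * (c * κ ^ γ) ^ (2 * (β : ℝ) - 2)) := by
          rw [hε_def]; ring
      _ ≤ _ := hscale
      _ = _ := by ring
  calc Torus.eScalarDissipation κ θ 0 T
      ≤ 2⁻¹ * (2 * Torus.eScalarDissipation κ θ 0 T) := by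
        rw [← mul_assoc, ENNReal.inv_mul_cancel two_ne_zero ENNReal.ofNat_ne_top, one_mul]
    _ ≤ 2⁻¹ * ENNReal.ofReal (2 * ((Cr.toNNReal : ℝ≥0) * κ ^ (((α : ℝ) + 2 * β - 1) / (α + 1)))) := by
        gcongr
        exact hraw.trans (ENNReal.ofReal_le_ofReal hreal)
    _ = ENNReal.ofReal ((Cr.toNNReal : ℝ≥0) * κ ^ (((α : ℝ) + 2 * β - 1) / (α + 1))) := by
        rw [ENNReal.ofReal_mul zero_le_two, ENNReal.ofReal_ofNat, ← mul_assoc,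
          ENNReal.inv_mul_cancel two_ne_zero ENNReal.ofNat_ne_top, one_mul]

end Literature.Barriers.AnomalousDissipation

end
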